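import Summits.NavierStokesRegularity.TurbBounds.FSU1.Corner
import Summits.NavierStokesRegularity.TurbBounds.FSU1.Mode.M03Defs
import Summits.NavierStokesRegularity.TurbBounds.FSU1.Mode.M06PhiRegime
import Summits.NavierStokesRegularity.TurbBounds.FSU1.Mode.M14Schur
import Summits.NavierStokesRegularity.TurbBounds.FSU1.Mode.M15Scalar

/-!
# FS-U1″ mode lemma — CellPackage (`TurbBounds/FSU1/Mode/M16CellPackage.lean`)

Scaling identities (`y = Ra^{1/12}`), `PH`/`PJ` facts, `SchurData`, and the per-cell scalar package `cell_scalars`.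

Cell-made mathematics of FS-PROOF-DRAFT §3 (pub-turb-sos), kernel-checked; generated from the design compose file
`StageF_compose.check.lean` (96c4b9bf…) by `build_mode_split.py`.  HONEST FRAMING: rigorous bounds for the stated PDE and boundary conditions; no claim about physical turbulence beyond the bound.
-/

open Real intervalIntegral MeasureTheory Set

namespace Summit.NavierStokesRegularity.TurbBounds.FSU1.Mode

open Summit.NavierStokesRegularity.TurbBounds.SpectralFormFreeSlip
open Summit.NavierStokesRegularity.TurbBounds.FSU1

/-! ## A.8 Scaling identities (`y = Ra^{1/12}`) and the cell / corner scalar packages -/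

section scaling
variable (p : Params) {y k : ℝ}

/-- `μ = y³ √(κ²+c)` with `κ = k/y³`. -/
theorem cast_c (p : Params) : ((p.c:ℚ):ℝ) = (p.bp:ℝ) / (p.a:ℝ) := by
  simp [Params.c]

/-- Cast of `b′ = b − a²/4` to `ℝ`. -/
theorem cast_bp (p : Params) : ((p.bp:ℚ):ℝ) = (p.b:ℝ) - (p.a:ℝ) ^ 2 / 4 := by
  simp [Params.bp]

/-- Scaling identity: `μ(α,β₀,k) = y³·√((k/y³)² + c)` at `α = a/y¹⁸`, `β₀ = b′/y¹²`. -/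
theorem muR_scaled (ha : (0:ℝ) < p.a) (hy : 0 < y) :
    muR ((p.a:ℝ) / y ^ 18) ((p.bp:ℝ) / y ^ 12) k = y ^ 3 * Real.sqrt ((k / y ^ 3) ^ 2 + (p.c:ℝ)) := by
  unfold muR
  have ha' : (p.a:ℝ) ≠ 0 := ha.ne'
  have hy' : y ≠ 0 := hy.ne'
  have hc : ((p.c:ℚ):ℝ) = (p.bp:ℝ) / (p.a:ℝ) := cast_c p
  have e : k ^ 2 + (p.bp:ℝ) / y ^ 12 / ((p.a:ℝ) / y ^ 18) = (y ^ 3) ^ 2 * ((k / y ^ 3) ^ 2 + (p.c:ℝ)) := by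
    rw [hc]; field_simp
  rw [e, Real.sqrt_mul (by positivity), Real.sqrt_sq (by positivity)]

/-- Scaling identity: `M(α,β₀,k) = y¹⁵/Φ(k/y³)`. -/
theorem Mhalf_scaled (ha : (0:ℝ) < p.a) (hc : (0:ℝ) < p.c) (hy : 0 < y) (hk : 0 < k) :
    Mhalf ((p.a:ℝ) / y ^ 18) ((p.bp:ℝ) / y ^ 12) k = y ^ 15 / Phi p (k / y ^ 3) := by
  unfold Mhalf Phi
  rw [muR_scaled p ha hy]
  have hs : 0 < Real.sqrt ((k / y ^ 3) ^ 2 + (p.c:ℝ)) := Real.sqrt_pos.mpr (by positivity)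
  have hy' : y ≠ 0 := hy.ne'
  have h1 : k + y ^ 3 * Real.sqrt ((k / y ^ 3) ^ 2 + (p.c:ℝ)) ≠ 0 := by positivity
  have h2 : k / y ^ 3 + Real.sqrt ((k / y ^ 3) ^ 2 + (p.c:ℝ)) ≠ 0 := by positivity
  field_simp

/-- `m̃(κ) = √(κ²+c)/κ` in closed form. -/
theorem mt_eq (hc : 0 < (p.c:ℝ)) {κ : ℝ} (hκ : 0 < κ) : mt p κ = Real.sqrt (κ ^ 2 + (p.c:ℝ)) / κ := by
  unfold mt
  rw [show 1 + (p.c:ℝ) / κ ^ 2 = (κ ^ 2 + (p.c:ℝ)) / κ ^ 2 by field_simp, Real.sqrt_div (by positivity),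
    Real.sqrt_sq hκ.le]

/-- Scaling identity: `m̃(α,β₀,k) = mt p (k/y³)`. -/
theorem mtR_scaled (ha : (0:ℝ) < p.a) (hc : 0 < (p.c:ℝ)) (hy : 0 < y) (hk : 0 < k) :
    mtR ((p.a:ℝ) / y ^ 18) ((p.bp:ℝ) / y ^ 12) k = mt p (k / y ^ 3) := by
  unfold mtR; rw [muR_scaled p ha hy, mt_eq p hc (by positivity)]
  field_simp

/-- Scaling identity for `P = (μ+k)/2`. -/
theorem Pof_scaled (ha : (0:ℝ) < p.a) (hy : 0 < y) (hk : 0 < k) :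
    Pof ((p.a:ℝ) / y ^ 18) ((p.bp:ℝ) / y ^ 12) k = y ^ 3 * (Real.sqrt ((k / y ^ 3) ^ 2 + (p.c:ℝ)) + k / y ^ 3) / 2 := by
  unfold Pof; rw [muR_scaled p ha hy]; field_simp

/-- Scaling identity for `Q = (μ−k)/2`. -/
theorem Qof_scaled (ha : (0:ℝ) < p.a) (hy : 0 < y) (_hk : 0 < k) :
    Qof ((p.a:ℝ) / y ^ 18) ((p.bp:ℝ) / y ^ 12) k = y ^ 3 * (Real.sqrt ((k / y ^ 3) ^ 2 + (p.c:ℝ)) - k / y ^ 3) / 2 := by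
  unfold Qof; rw [muR_scaled p ha hy]; field_simp

end scaling

/-- The coefficients of `PH` are non-negative. -/
theorem PHc_nonneg : ∀ q ∈ PHc, 0 ≤ q := by norm_num [PHc]
/-- The coefficients of `PJ` are non-negative. -/
theorem PJc_nonneg : ∀ q ∈ PJc, 0 ≤ q := by norm_num [PJc]

/-- `PH` is non-decreasing on `[0,∞)`. -/
theorem PH_mono {x y : ℝ} (hx : 0 ≤ x) (hxy : x ≤ y) : PH x ≤ PH y := by
  unfold PH evenPoly; exact evenPoly_foldr_mono PHc PHc_nonneg hx hxy
/-- `PJ` is non-decreasing on `[0,∞)`. -/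
theorem PJ_mono {x y : ℝ} (hx : 0 ≤ x) (hxy : x ≤ y) : PJ x ≤ PJ y := by
  unfold PJ evenPoly; exact evenPoly_foldr_mono PJc PJc_nonneg hx hxy
/-- `PJ ≥ 0`. -/
theorem PJ_nonneg {x : ℝ} : 0 ≤ PJ x := by
  unfold PJ evenPoly; exact evenPoly_foldr_nonneg PJc PJc_nonneg x

/-- `‖H_ρ‖² ≥ 0`. -/
theorem HnormSq_nonneg (ρ : ℝ) : 0 ≤ HnormSq ρ :=
  intervalIntegral.integral_nonneg zero_le_one fun _ _ => sq_nonneg _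
/-- `J(ρ) ≥ 0`. -/
theorem Jfun_nonneg (ρ : ℝ) : 0 ≤ Jfun ρ :=
  intervalIntegral.integral_nonneg zero_le_one fun _ _ =>
    intervalIntegral.integral_nonneg zero_le_one fun _ _ => sq_nonneg _

/-- The scalar data a half-cell needs: `σ` (stiffness weight) and `ε` (Schur split) with the four inequalities. -/
def SchurData (α β₀ δ k σ eps : ℝ) : Prop :=
  0 < σ ∧ σ * Mhalf α β₀ k * evenBracket α β₀ k ≤ 1 ∧ σ * Mhalf α β₀ k ≤ 1 ∧ 0 < eps ∧ eps < 1 ∧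
    (Real.sqrt (δ ^ 3 * HnormSq (k * δ)) / 2) ^ 2 / ((1 - eps) * σ)
      + (Real.sqrt (Jfun (k * δ)) / k / 2) ^ 2 / (eps * (α * (π ^ 2 / (4 * δ ^ 2)) + (α * k ^ 2 + β₀))) ≤ 1

/-- Basic real consequences of `ScalarLines`. -/
theorem scalar_basics (p : Params) (hS : ScalarLines p) :
    (0:ℝ) < p.a ∧ (0:ℝ) < p.bp ∧ (0:ℝ) < p.c ∧ (0:ℝ) < p.D ∧ (0:ℝ) < p.kapI ∧ (p.rhoI:ℝ) ≤ 1 ∧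
    (p.rhoI : ℝ) = (p.kapI:ℝ) * (p.D:ℝ) / 10 ∧ (p.c:ℝ) / 3 ≤ (p.kapI:ℝ) ^ 2 ∧
    (p.bp : ℝ) ≤ (p.a:ℝ) * (p.kapI:ℝ) ^ 2 * (1 + π ^ 2 * 100 / (4 * ((p.kapI:ℝ) * (p.D:ℝ)) ^ 2)) ∧
    (p.c : ℝ) = (p.bp:ℝ) / (p.a:ℝ) ∧ (2 * (p.D:ℝ)) ^ 12 ≤ 10 ^ 30 ∧ 3 ≤ (p.kapI:ℝ) * R4 := by
  obtain ⟨ha, _hb, _hb1, hab, _hu0, _hu1, hD, hD12, hρ0, hρ1, hk2, _hI0, hbp, hkc⟩ := hS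
  have hbpQ : 0 < p.bp := by unfold Params.bp; nlinarith
  have hcQ : 0 < p.c := by unfold Params.c; exact div_pos hbpQ ha
  have hkapQ : 0 < p.kapI := by unfold Params.kapI; positivity
  have hρ : (p.rhoI : ℚ) = p.kapI * p.D / 10 := by
    unfold Params.kapI; field_simp
  have hk2' : p.c / 3 ≤ p.kapI ^ 2 := by unfold Params.kstar2 at hk2; exact hk2
  have haR : (0:ℝ) < p.a := by exact_mod_cast ha
  have hDR : (0:ℝ) < p.D := by exact_mod_cast hD
  have hkR : (0:ℝ) < p.kapI := by exact_mod_cast hkapQ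
  have hρR : (p.rhoI : ℝ) = (p.kapI:ℝ) * (p.D:ℝ) / 10 := by exact_mod_cast hρ
  refine ⟨haR, by exact_mod_cast hbpQ, by exact_mod_cast hcQ, hDR, hkR, by exact_mod_cast hρ1, hρR,
    by exact_mod_cast hk2', ?_, cast_c p, by exact_mod_cast hD12, hkc⟩
  have e : π ^ 2 * 100 / (4 * ((p.kapI:ℝ) * (p.D:ℝ)) ^ 2) = π ^ 2 / (4 * (p.rhoI:ℝ) ^ 2) := by
    rw [hρR]; field_simp; ring
  rw [e]; exact hbp

/-- CELL scalar package: everything `half_nonneg` needs on a covered cell, from `CellIneq` + the two majorants. -/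
theorem cell_scalars (p : Params) (hS : ScalarLines p) {y k : ℝ} (hy : 0 < y) (hy2 : 10 ≤ y ^ 2) (hk : 0 < k)
    {ka kb eps : ℚ} (hcell : CellIneq p ka kb eps) (hka : (ka:ℝ) ≤ k / y ^ 3) (hkb : k / y ^ 3 ≤ kb)
    (hH : MajorH) (hJ : MajorJ) :
    SchurData ((p.a:ℝ) / y ^ 18) ((p.bp:ℝ) / y ^ 12) ((p.D:ℝ) / y ^ 5) k
      (Fcell p ka kb * PhiInf p ka kb / y ^ 15) eps := by
  unfold SchurData
  obtain ⟨ha, hbp, hc, hD, hkapI, hρI1, hρI, hk2, hbpk, hcdef, hD12, -⟩ := scalar_basics p hS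
  have haQ : 0 < p.a := hS.1
  have habQ : p.a ^ 2 < 4 * p.b := hS.2.2.2.1
  obtain ⟨hka0, hkakb, hkbI, he0, he1, hmb, hPinf, hF, hineq⟩ := hcell
  have hka0R : (0:ℝ) ≤ ka := by exact_mod_cast hka0
  have hkbIR : (kb:ℝ) ≤ p.kapI := by exact_mod_cast hkbI
  have he0R : (0:ℝ) < eps := by exact_mod_cast he0
  have he1R : (eps:ℝ) < 1 := by exact_mod_cast he1
  have hy3 : R4 ≤ y ^ 3 := R4_le_cube hy hy2
  -- scaling identities (stated with the raw expressions, then abbreviated by `set`)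
  have hM := Mhalf_scaled p ha hc hy hk
  have hmt := mtR_scaled p ha hc hy hk
  have hP := Pof_scaled p ha hy hk
  have hQ := Qof_scaled p ha hy hk
  set α : ℝ := (p.a:ℝ) / y ^ 18 with hαdef
  set β₀ : ℝ := (p.bp:ℝ) / y ^ 12 with hβdef
  set δ : ℝ := (p.D:ℝ) / y ^ 5 with hδdef
  set σ : ℝ := Fcell p ka kb * PhiInf p ka kb / y ^ 15 with hσdef
  set κ : ℝ := k / y ^ 3 with hκdef
  have hκ0 : 0 < κ := by rw [hκdef]; positivity
  have hkκ : k = κ * y ^ 3 := by rw [hκdef]; field_simp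
  set s : ℝ := Real.sqrt (κ ^ 2 + (p.c:ℝ)) with hsdef
  obtain ⟨hs0, hssq, hκs, -⟩ := sqrt_facts hc hκ0.le
  -- (1) `σ > 0`
  have hσ : 0 < σ := by rw [hσdef]; positivity
  -- (2) `σ·M = F·(inf Φ / Φ(κ))`
  have hPhi : 0 < Phi p κ := by unfold Phi; positivity
  have hσM : σ * Mhalf α β₀ k = Fcell p ka kb * (PhiInf p ka kb / Phi p κ) := by
    rw [hM, hσdef]; field_simp
  have hq : PhiInf p ka kb / Phi p κ ≤ 1 := by
    rw [div_le_one hPhi]; exact PhiInf_le_Phi p haQ habQ hka0 hka hkb hκ0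
  have hq0 : 0 ≤ PhiInf p ka kb / Phi p κ := by positivity
  -- (3) `F ≤ 1`
  have hmb1 : (0:ℝ) < mt p kb - 1 := by linarith
  have hPfn : 0 < Pfn p ka := by
    unfold Pfn
    obtain ⟨_, _, hkas, _⟩ := sqrt_facts hc hka0R
    have : 0 < Real.sqrt ((ka:ℝ) ^ 2 + (p.c:ℝ)) + ka := by linarith
    have := R4_pos; positivity
  have hE0 : 0 ≤ eps1bar p ka kb := by
    unfold eps1bar; have := Real.sinh_pos_iff.mpr hPfn; positivity
  have hG0 : 0 ≤ Gbar ((ka:ℝ) * R4) := Gbar_nonneg _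
  have hF1 : Fcell p ka kb ≤ 1 := by
    unfold Fcell
    rw [div_le_one (by positivity)]
    have : 0 ≤ Gbar ((ka:ℝ) * R4) * ((mt p kb + 1) / (mt p kb - 1)) + 2 * eps1bar p ka kb / (mt p kb - 1) := by
      positivity
    linarith
  -- (4) the bracket bound `evenBracket ≤ 1/F`
  have hmκ : mt p kb ≤ mt p κ := by unfold mt; exact mtilde_anti hc.le hκ0 hkb
  have hmbR : 1 < mt p (kb:ℝ) := hmb
  have hPge : Pfn p ka ≤ Pof α β₀ k := by
    rw [hP]; unfold Pfn
    obtain ⟨_, _, hkas, _⟩ := sqrt_facts hc hka0R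
    have h1 : Real.sqrt ((ka:ℝ) ^ 2 + (p.c:ℝ)) ≤ s :=
      Real.sqrt_le_sqrt (by linarith only [pow_le_pow_left₀ hka0R hka 2])
    have h2 : Real.sqrt ((ka:ℝ) ^ 2 + (p.c:ℝ)) + ka ≤ s + κ := by linarith
    have h3 : 0 ≤ Real.sqrt ((ka:ℝ) ^ 2 + (p.c:ℝ)) + ka := by linarith
    have := mul_le_mul hy3 h2 h3 (by positivity)
    linarith
  have hQge : Qfn p kb ≤ Qof α β₀ k := by
    rw [hQ]
    have hq1 := Qfn_anti (c := (p.c:ℝ)) (R := y ^ 3) (by positivity) hc hκ0.le hkb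
    unfold Qfn
    obtain ⟨_, _, hkbs, _⟩ := sqrt_facts hc (le_trans hka0R (le_trans hka hkb))
    have h3 : 0 ≤ Real.sqrt ((kb:ℝ) ^ 2 + (p.c:ℝ)) - kb := by linarith
    have := mul_le_mul_of_nonneg_right hy3 h3
    rw [← hsdef] at hq1
    linarith only [hq1, this]
  have hQP : Qof α β₀ k ≤ Pof α β₀ k := by
    rw [hP, hQ]; have h := mul_pos hκ0 (pow_pos hy 3); linarith only [h]
  have hε1 : eps1 α β₀ k ≤ eps1bar p ka kb := by
    unfold eps1 eps1bar; exact eps1_le_of hPfn hPge hQge hQP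
  have hk0k : (ka:ℝ) * R4 ≤ k := by rw [hkκ]; exact mul_le_mul hka hy3 R4_pos.le hκ0.le
  have hg : gplus k ≤ Gbar ((ka:ℝ) * R4) := gplus_le_Gbar hk0k
  have hbr : evenBracket α β₀ k ≤ 1 / Fcell p ka kb := by
    unfold evenBracket; rw [hmt]; unfold Fcell; rw [one_div_one_div]
    exact bracket_mono hg hG0 hε1 hE0 hmbR hmκ
  -- (5) conclusions (ii), (iii)
  have hF0 := hF
  have hii : σ * Mhalf α β₀ k * evenBracket α β₀ k ≤ 1 := by
    rw [hσM]
    by_cases hb : evenBracket α β₀ k ≤ 0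
    · have : 0 ≤ Fcell p ka kb * (PhiInf p ka kb / Phi p κ) := by positivity
      exact le_trans (mul_nonpos_of_nonneg_of_nonpos this hb) zero_le_one
    · push Not at hb
      calc Fcell p ka kb * (PhiInf p ka kb / Phi p κ) * evenBracket α β₀ k
          ≤ Fcell p ka kb * 1 * evenBracket α β₀ k := by
            apply mul_le_mul_of_nonneg_right _ hb.le
            exact mul_le_mul_of_nonneg_left hq hF.le
        _ ≤ Fcell p ka kb * (1 / Fcell p ka kb) := by
            rw [mul_one]; exact mul_le_mul_of_nonneg_left hbr hF.le
        _ = 1 := by field_simp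
  have hiii : σ * Mhalf α β₀ k ≤ 1 := by
    rw [hσM]
    calc Fcell p ka kb * (PhiInf p ka kb / Phi p κ) ≤ 1 * 1 := mul_le_mul hF1 hq hq0 zero_le_one
      _ = 1 := by ring
  -- (6) the Schur condition
  have hδ0 : 0 < δ := by rw [hδdef]; positivity
  set ρ : ℝ := k * δ with hρdef
  have hρκ : ρ = κ * (p.D:ℝ) / y ^ 2 := by rw [hρdef, hδdef, hkκ]; field_simp; try ring
  have hρ0 : 0 ≤ ρ := by rw [hρdef]; positivity
  have hρb : ((rhoB p kb : ℚ) : ℝ) = (kb:ℝ) * (p.D:ℝ) / 10 := by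
    have h : rhoB p kb = kb * p.D / 10 := by unfold rhoB; ring
    exact_mod_cast h
  have hρle : ρ ≤ (kb:ℝ) * (p.D:ℝ) / 10 := by
    rw [hρκ, div_le_div_iff₀ (by positivity) (by norm_num)]
    have : κ * (p.D:ℝ) * 10 ≤ κ * (p.D:ℝ) * y ^ 2 := mul_le_mul_of_nonneg_left hy2 (by positivity)
    linarith only [this, mul_le_mul_of_nonneg_right hkb (by positivity : (0:ℝ) ≤ (p.D:ℝ) * y ^ 2)]
  have hρ1 : ρ ≤ 1 := by
    refine le_trans hρle ?_
    rw [hρI] at hρI1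
    refine le_trans ?_ hρI1
    exact div_le_div_of_nonneg_right (mul_le_mul_of_nonneg_right hkbIR hD.le) (by norm_num)
  have hHb : HnormSq ρ ≤ PH ((rhoB p kb : ℚ) : ℝ) := by
    rw [hρb]; exact le_trans (hH ρ hρ0 hρ1) (PH_mono hρ0 hρle)
  have hJb : Jfun ρ ≤ ρ ^ 4 * PJ ((rhoB p kb : ℚ) : ℝ) := by
    rw [hρb]; exact le_trans (hJ ρ hρ0 hρ1) (mul_le_mul_of_nonneg_left (PJ_mono hρ0 hρle) (by positivity))
  -- first term
  have h1e : 0 < 1 - (eps:ℝ) := by linarith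
  have hB1 : (Real.sqrt (δ ^ 3 * HnormSq (k * δ)) / 2) ^ 2 / ((1 - eps) * σ) ≤ r1sq p ka kb / (1 - eps) := by
    rw [div_pow, Real.sq_sqrt (mul_nonneg (pow_nonneg hδ0.le 3) (HnormSq_nonneg _))]
    have e : r1sq p ka kb / (1 - eps) = δ ^ 3 * PH ((rhoB p kb : ℚ) : ℝ) / 2 ^ 2 / ((1 - eps) * σ) := by
      unfold r1sq; rw [hσdef, hδdef]; field_simp; ring
    rw [e]
    apply div_le_div_of_nonneg_right _ (by positivity)
    apply div_le_div_of_nonneg_right _ (by positivity)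
    exact mul_le_mul_of_nonneg_left hHb (by positivity)
  -- second term
  set ν : ℝ := α * (π ^ 2 / (4 * δ ^ 2)) + (α * k ^ 2 + β₀) with hνdef
  have hν : 0 < ν := by rw [hνdef, hαdef, hβdef, hδdef]; positivity
  set Den : ℝ := (p.a:ℝ) * π ^ 2 * y ^ 4 / (4 * (p.D:ℝ) ^ 2) + (p.a:ℝ) * κ ^ 2 + (p.bp:ℝ) with hDendef
  have hrat : ρ ^ 4 / (k ^ 2 * ν) = κ ^ 2 * (p.D:ℝ) ^ 4 / (y ^ 2 * Den) := by
    rw [hρdef, hνdef, hDendef, hαdef, hβdef, hδdef, hkκ]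
    field_simp; ring
  set Den10 : ℝ := (p.a:ℝ) * π ^ 2 * 100 / (4 * (p.D:ℝ) ^ 2) + (p.a:ℝ) * κ ^ 2 + (p.bp:ℝ) with hDen10def
  have hDen10pos : 0 < Den10 := by rw [hDen10def]; positivity
  have hy4 : (100:ℝ) ≤ y ^ 4 := by
    have h := mul_le_mul hy2 hy2 (by norm_num) (by positivity); linarith only [h]
  have hDD : 10 * Den10 ≤ y ^ 2 * Den := by
    have h1 : Den10 ≤ Den := by
      rw [hDendef, hDen10def]
      have : (p.a:ℝ) * π ^ 2 * 100 / (4 * (p.D:ℝ) ^ 2) ≤ (p.a:ℝ) * π ^ 2 * y ^ 4 / (4 * (p.D:ℝ) ^ 2) :=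
        div_le_div_of_nonneg_right (mul_le_mul_of_nonneg_left hy4 (by positivity)) (by positivity)
      linarith
    have e1 := mul_le_mul_of_nonneg_right hy2 hDen10pos.le
    have e2 := mul_le_mul_of_nonneg_left h1 (pow_pos hy 2).le
    exact le_trans e1 e2
  have hnu : nuDen p kb = (p.a:ℝ) * π ^ 2 * 100 / (4 * (p.D:ℝ) ^ 2) + (p.a:ℝ) * (kb:ℝ) ^ 2 + (p.bp:ℝ) := rfl
  have hnuD : 0 < nuDen p kb := by rw [hnu]; positivity
  have hmono : κ ^ 2 / Den10 ≤ (kb:ℝ) ^ 2 / nuDen p kb := by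
    rw [div_le_div_iff₀ hDen10pos hnuD, hnu, hDen10def]
    have hκb2 : κ ^ 2 ≤ (kb:ℝ) ^ 2 := pow_le_pow_left₀ hκ0.le hkb 2
    have hA : 0 ≤ (p.a:ℝ) * π ^ 2 * 100 / (4 * (p.D:ℝ) ^ 2) + (p.bp:ℝ) := by positivity
    linarith only [mul_le_mul_of_nonneg_left hκb2 hA]
  have hrat_le : ρ ^ 4 / (k ^ 2 * ν) ≤ (kb:ℝ) ^ 2 * (p.D:ℝ) ^ 4 / (10 * nuDen p kb) := by
    rw [hrat]
    calc κ ^ 2 * (p.D:ℝ) ^ 4 / (y ^ 2 * Den) ≤ κ ^ 2 * (p.D:ℝ) ^ 4 / (10 * Den10) :=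
          div_le_div_of_nonneg_left (by positivity) (by positivity) hDD
      _ = (p.D:ℝ) ^ 4 / 10 * (κ ^ 2 / Den10) := by rw [div_mul_div_comm]; ring
      _ ≤ (p.D:ℝ) ^ 4 / 10 * ((kb:ℝ) ^ 2 / nuDen p kb) := mul_le_mul_of_nonneg_left hmono (by positivity)
      _ = (kb:ℝ) ^ 2 * (p.D:ℝ) ^ 4 / (10 * nuDen p kb) := by rw [div_mul_div_comm]; ring
  have hB2 : (Real.sqrt (Jfun (k * δ)) / k / 2) ^ 2 / (eps * ν) ≤ r2sq p kb (rhoB p kb) / eps := by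
    rw [div_pow, div_pow, Real.sq_sqrt (Jfun_nonneg _)]
    have step1 : Jfun (k * δ) / k ^ 2 / 2 ^ 2 / (eps * ν) ≤ ρ ^ 4 * PJ ((rhoB p kb : ℚ) : ℝ) / k ^ 2 / 2 ^ 2 / (eps * ν) := by
      apply div_le_div_of_nonneg_right _ (by positivity)
      apply div_le_div_of_nonneg_right _ (by positivity)
      exact div_le_div_of_nonneg_right hJb (by positivity)
    refine le_trans step1 ?_
    have e1 : ρ ^ 4 * PJ ((rhoB p kb : ℚ) : ℝ) / k ^ 2 / 2 ^ 2 / (eps * ν)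
        = PJ ((rhoB p kb : ℚ) : ℝ) / (4 * eps) * (ρ ^ 4 / (k ^ 2 * ν)) := by ring
    have e2 : r2sq p kb (rhoB p kb) / eps
        = PJ ((rhoB p kb : ℚ) : ℝ) / (4 * eps) * ((kb:ℝ) ^ 2 * (p.D:ℝ) ^ 4 / (10 * nuDen p kb)) := by
      unfold r2sq; field_simp
    rw [e1, e2]
    exact mul_le_mul_of_nonneg_left hrat_le (by have := PJ_nonneg (x := ((rhoB p kb : ℚ) : ℝ)); positivity)
  refine ⟨hσ, hii, hiii, he0R, he1R, ?_⟩
  calc _ ≤ r1sq p ka kb / (1 - eps) + r2sq p kb (rhoB p kb) / eps := add_le_add hB1 hB2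
    _ ≤ 1 := hineq

end Summit.NavierStokesRegularity.TurbBounds.FSU1.Mode
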